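import Mathlib
import HarnessLib
import HarnessLib.Audit
import Summits.Parity.Statement
import Literature.Barriers.Parity.SiegelZeroDichotomy

/-!
Route: HomothetyPencil

DORMANT since 2026-09-04T15:42:10Z (reconciler: no traction for 5 d (last activity statement-checked at 2026-08-30T14:21:33Z); parked, not closed — `ledger route dormant route-Parity-HomothetyPencil --off` to reactivate) — unstaffed, not closed; items shared with open routes are served there. `ledger route dormant <id> --off` reactivates.

# Route HomothetyPencil — GHL ⟸ the record's Siegel/uniform leaves ∧ Hardy–Littlewood along the
guarded homothety pencil q·Ψ (q ≤ N^(3/10)) ∧ pencil rigidity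

decomp-parity (D-0178/D-0179) lens-4 g7 node «HomothetyPencil» (lens «minimal-counterexample /
extremal reduction», RESIDUAL mode): an
ALTERNATIVE DECOMPOSITION of the record route route-Parity-SiegelSpectrumSplit beneath its two
FIXED-PATTERN leaves FU = stmt-Parity-26852 and
FL = stmt-Parity-26863 jointly, on an axis no cell node uses: the GUARDED HOMOTHETY PENCIL of a
shape Ψ — the dilates q·Ψ := (same linear parts,
constants × q) for q ≡ 1 mod primorial(max t L), q ≤ N^(3/10) (kernel `dilate`, `pencil`,
`strideMod`). A minimal counterexample Ψ to fixed-pattern HL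
is measured against its own pencil: either HL fails for a positive proportion of its guarded dilates
(¬PencilHL) or the HL error of Ψ differs from that of
almost all of its dilates (¬PencilRigidity) — kernel `counterexample_dichotomy`. It suffices to show
X = Q ∧ UU ∧ UL ∧ PencilHL ∧ PencilRigidity, where
Q (25148), UU (26853), UL (26864) are the record's items VERBATIM (shared by signature), PencilHL :=
«for every fixed non-degenerate Ψ (all d, t), HL with
error ≤ εN^d holds for all but an ε-proportion of the guarded dilates q ≤ N^(3/10)» (NEW, credited,
rank 2) and PencilRigidity := «for all but an
ε-proportion of the guarded dilates the HL error of q·Ψ equals that of Ψ up to εN^d» (NEW, DECLARED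
RESIDUAL, rank 3). Kernel
HOME/decomp-parity-lens-4/g7/HomothetyPencil.lean (537 lines, rc 0, 0 sorry, axioms standard): G2
certificate `localFactor_dilate_eq` /
`singularProduct_pos_iff_dilate` (a guarded dilate has the same local factors at every p ≤ max t L
and the same admissibility), `fixed_of_pencilR :
PencilHL → PencilRigidity → (FU ∧ FL)`, necessity `pencilHL_of_ghl`, `pencilRigidity_of_ghl`
(hyp-free: GHL's uniformity in ‖Ψ‖_N ≤ L covers every
dilate with q ≤ 2N, kernel `affLinSize_dilate_le`), exactness `node_iffR : (FU ∧ FL) ↔ (PencilHL ∧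
PencilRigidity)` given Q, UU, UL; `closes` with 5/5
binders by pure logic (render-test rc 0).
Lean: `(∃ η₀ : ℝ, ∃ q₀ : ℕ, ∀ (q : ℕ) [NeZero q] (χ : DirichletCharacter ℂ q) (η : ℝ), q₀ ≤ q →
Literature.Barriers.Parity.IsSiegelZero χ η → η < η₀) ∧ ((∃ η₀ : ℝ, ∃ q₀ : ℕ, ∀ (q : ℕ) [NeZero q]
(χ : DirichletCharacter ℂ q) (η : ℝ), q₀ ≤ q → Literature.Barriers.Parity.IsSiegelZero χ η → η < η₀)
→ (∀ (d t : ℕ), 1 ≤ d → 1 ≤ t → ∀ Ψ : Fin t → Literature.NumberTheory.Sieve.AffLinForm d,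
Literature.NumberTheory.Sieve.IsNondegenerateSystem Ψ → ∀ ε : ℝ, 0 < ε → ∃ N₀ : ℕ, ∀ N : ℕ, N₀ ≤ N →
∀ K : Set (Fin d → ℝ), Convex ℝ K → K ⊆ Literature.NumberTheory.Sieve.realBox d N →
Literature.NumberTheory.Sieve.vonMangoldtSum Ψ K N - Literature.NumberTheory.Sieve.archFactor Ψ K *
Literature.NumberTheory.Sieve.singularProduct Ψ ≤ ε * (N : ℝ) ^ d) → ∀ (d t L : ℕ), 1 ≤ d → 1 ≤ t →
∀ ε : ℝ, 0 < ε → ∃ N₀ : ℕ, ∀ N : ℕ, N₀ ≤ N → ∀ Ψ : Fin t → Literature.NumberTheory.Sieve.AffLinForm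
d, Literature.NumberTheory.Sieve.IsNondegenerateSystem Ψ → Literature.NumberTheory.Sieve.affLinSize
Ψ N ≤ L → ∀ K : Set (Fin d → ℝ), Convex ℝ K → K ⊆ Literature.NumberTheory.Sieve.realBox d N →
Literature.NumberTheory.Sieve.vonMangoldtSum Ψ K N - Literature.NumberTheory.Sieve.archFactor Ψ K *
Literature.NumberTheory.Sieve.singularProduct Ψ ≤ ε * (N : ℝ) ^ d) ∧ ((∃ η₀ : ℝ, ∃ q₀ : ℕ, ∀ (q : ℕ)
[NeZero q] (χ : DirichletCharacter ℂ q) (η : ℝ), q₀ ≤ q → Literature.Barriers.Parity.IsSiegelZero χ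
η → η < η₀) → (∀ (d t : ℕ), 1 ≤ d → 1 ≤ t → ∀ Ψ : Fin t → Literature.NumberTheory.Sieve.AffLinForm
d, Literature.NumberTheory.Sieve.IsNondegenerateSystem Ψ → ∀ ε : ℝ, 0 < ε → ∃ N₀ : ℕ, ∀ N : ℕ, N₀ ≤
N → ∀ K : Set (Fin d → ℝ), Convex ℝ K → K ⊆ Literature.NumberTheory.Sieve.realBox d N →
Literature.NumberTheory.Sieve.archFactor Ψ K * Literature.NumberTheory.Sieve.singularProduct Ψ -
Literature.NumberTheory.Sieve.vonMangoldtSum Ψ K N ≤ ε * (N : ℝ) ^ d) → ∀ (d t L : ℕ), 1 ≤ d → 1 ≤ t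
→ ∀ ε : ℝ, 0 < ε → ∃ N₀ : ℕ, ∀ N : ℕ, N₀ ≤ N → ∀ Ψ : Fin t →
Literature.NumberTheory.Sieve.AffLinForm d, Literature.NumberTheory.Sieve.IsNondegenerateSystem Ψ →
Literature.NumberTheory.Sieve.affLinSize Ψ N ≤ L → ∀ K : Set (Fin d → ℝ), Convex ℝ K → K ⊆
Literature.NumberTheory.Sieve.realBox d N → Literature.NumberTheory.Sieve.archFactor Ψ K *
Literature.NumberTheory.Sieve.singularProduct Ψ - Literature.NumberTheory.Sieve.vonMangoldtSum Ψ K N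
≤ ε * (N : ℝ) ^ d) ∧ (∀ (d t L : ℕ), 1 ≤ d → 1 ≤ t → ∀ ε : ℝ, 0 < ε → ∃ N₀ : ℕ, ∀ N : ℕ, N₀ ≤ N → ∀
Ψ : Fin t → Literature.NumberTheory.Sieve.AffLinForm d,
Literature.NumberTheory.Sieve.IsNondegenerateSystem Ψ → Literature.NumberTheory.Sieve.affLinSize Ψ 1
≤ L → ∀ K : Set (Fin d → ℝ), Convex ℝ K → K ⊆ Literature.NumberTheory.Sieve.realBox d N → ∃ B :
Finset ℕ, B ⊆ (Finset.range (⌊(N : ℝ) ^ ((3 : ℝ) / 10)⌋₊ / primorial (max t L) + 1)).image (fun m :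
ℕ => 1 + primorial (max t L) * m) ∧ (B.card : ℝ) ≤ ε * (((Finset.range (⌊(N : ℝ) ^ ((3 : ℝ) / 10)⌋₊
/ primorial (max t L) + 1)).image (fun m : ℕ => 1 + primorial (max t L) * m)).card : ℝ) ∧ ∀ q ∈
(Finset.range (⌊(N : ℝ) ^ ((3 : ℝ) / 10)⌋₊ / primorial (max t L) + 1)).image (fun m : ℕ => 1 +
primorial (max t L) * m), q ∉ B → |Literature.NumberTheory.Sieve.vonMangoldtSum (fun i => (⟨(Ψ
i).coeff, (q : ℤ) * (Ψ i).const⟩ : Literature.NumberTheory.Sieve.AffLinForm d)) K N -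
Literature.NumberTheory.Sieve.archFactor (fun i => (⟨(Ψ i).coeff, (q : ℤ) * (Ψ i).const⟩ :
Literature.NumberTheory.Sieve.AffLinForm d)) K * Literature.NumberTheory.Sieve.singularProduct (fun
i => (⟨(Ψ i).coeff, (q : ℤ) * (Ψ i).const⟩ : Literature.NumberTheory.Sieve.AffLinForm d))| ≤ ε * (N
: ℝ) ^ d) ∧ (∀ (d t L : ℕ), 1 ≤ d → 1 ≤ t → ∀ ε : ℝ, 0 < ε → ∃ N₀ : ℕ, ∀ N : ℕ, N₀ ≤ N → ∀ Ψ : Fin t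
→ Literature.NumberTheory.Sieve.AffLinForm d, Literature.NumberTheory.Sieve.IsNondegenerateSystem Ψ
→ Literature.NumberTheory.Sieve.affLinSize Ψ 1 ≤ L → ∀ K : Set (Fin d → ℝ), Convex ℝ K → K ⊆
Literature.NumberTheory.Sieve.realBox d N → ∃ E : Finset ℕ, E ⊆ (Finset.range (⌊(N : ℝ) ^ ((3 : ℝ) /
10)⌋₊ / primorial (max t L) + 1)).image (fun m : ℕ => 1 + primorial (max t L) * m) ∧ (E.card : ℝ) ≤
ε * (((Finset.range (⌊(N : ℝ) ^ ((3 : ℝ) / 10)⌋₊ / primorial (max t L) + 1)).image (fun m : ℕ => 1 +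
primorial (max t L) * m)).card : ℝ) ∧ ∀ q ∈ (Finset.range (⌊(N : ℝ) ^ ((3 : ℝ) / 10)⌋₊ / primorial
(max t L) + 1)).image (fun m : ℕ => 1 + primorial (max t L) * m), q ∉ E →
|(Literature.NumberTheory.Sieve.vonMangoldtSum (fun i => (⟨(Ψ i).coeff, (q : ℤ) * (Ψ i).const⟩ :
Literature.NumberTheory.Sieve.AffLinForm d)) K N - Literature.NumberTheory.Sieve.archFactor (fun i
=> (⟨(Ψ i).coeff, (q : ℤ) * (Ψ i).const⟩ : Literature.NumberTheory.Sieve.AffLinForm d)) K *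
Literature.NumberTheory.Sieve.singularProduct (fun i => (⟨(Ψ i).coeff, (q : ℤ) * (Ψ i).const⟩ :
Literature.NumberTheory.Sieve.AffLinForm d))) - (Literature.NumberTheory.Sieve.vonMangoldtSum Ψ K N
- Literature.NumberTheory.Sieve.archFactor Ψ K * Literature.NumberTheory.Sieve.singularProduct Ψ)| ≤
ε * (N : ℝ) ^ d)`

## Assembly
Pure logic plus two elementary inequalities (|b| ≤ X ∧ |b − a| ≤ Y ⟹ |a| ≤ X + Y; two exceptional
sets of relative size ≤ 1/4 in a pencil containing
q = 1 leave a good q): from hP and hR at ε' = min(ε/2, 1/4) pick a good dilate q and transport its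
HL error to Ψ — this is fixed-pattern two-sided HL,
i.e. FU ∧ FL (kernel fixed_of_pencilR, render-test `closes.fixed`); then hUU hQ hFU and hUL hQ hFL
are the record's uniform halves and |a − b| ≤ c ⟺
(a − b ≤ c ∧ b − a ≤ c) with N₀ := max gives GHL (`closes` in glue.lean, 5/5 binders consumed; the
Assembly item records the same implication). Exactness in the kernel:
node_iffR ((FU ∧ FL) ↔ (PencilHL ∧ PencilRigidity) given Q, UU, UL) and piecesR_of_ghl (GHL →
PencilHL ∧ PencilRigidity, hyp-free).

Rationale: WHY THIS LINE. The lens «minimal counterexample / extremal reduction» is applied to the SHAPE of a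
counterexample rather than to its size: the homothety q·Ψ keeps the
linear type (hence the parity / complexity class and, under the guard q ≡ 1 mod primorial(max t L),
every small local factor — kernel
`localFactor_dilate_eq`) and moves only the constants, so «Ψ is a counterexample» splits exactly
into «its pencil is bad on average» or «Ψ is not rigid
inside its pencil», and the first alternative is a statement with ONE EXTRA AVERAGING VARIABLE of
polynomial length N^(3/10) — the regime where the
Heath-Brown identity, mean values of Dirichlet polynomials and short-interval Gowers uniformity act
unconditionally: pairs n, n + h for all but
O(H log^-A X) shifts |h − h₀| ≤ H, H ≥ X^(8/33+ε) (MatomakiRadziwillTao2019 Thm 1.3(i),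
arXiv:1707.01315 p. 6; 8/33 < 3/10), ℓ-tuples n + c_i·h for
proportion 1 − o(1) of h ≤ H = X^(1/3+ε) (Matomäki–Shao–Tao–Teräväinen II, arXiv:2411.05770 Thm 1.5
p. 6, «coefficients 0,…,ℓ−1 can be replaced by any
fixed distinct integers» = exactly the d = 1 unit-coefficient dilates), H = X^(5/8+ε) from part I
(arXiv:2204.03754 Thm 1.7); the credited piece sits
one notch below the printed tuple floor (3/10 < 1/3, the d₃ / Type-I₃ obstacle of arXiv:2411.05770
Remark 1.10) and above the pair floor 8/33, for ALL
d and all coefficient shapes (the typed FU/FL are all-d). Imported: multiplicative number theory of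
short intervals (Heath-Brown identity, Type I/II,
large values of Dirichlet polynomials) and higher-order Fourier analysis in short intervals (MSTT
contagion / nilsequence equidistribution). Versus prior
routes and the negatives index: every cell node so far moves along TRANSLATION (shift windows
N^(1/8): TelescopingWindows 31164/31165, ShiftTauberian),
SCALE (ScaleTauberianCarving, closed as costume T18), Gowers CUBES (ConstellationCubes 30019/30020),
Siegel QUALITY, populations or gap limit points; none
dilates the constants at fixed linear part, and the negatives index (5 rows) has no dilation
statement. The dilation axis is the only one of these on
which necessity from GHL is literal (a dilate is again a bounded-size system at the same N) AND the
Siegel-zero secondary term is provably sparse along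
the family (MatomakiMerikoski2023: distortion at shifts divisible by large divisors of the
exceptional modulus), so both new pieces are typed BARE (no Q
prefix) and the credited one is Siegel-inert.

RANKED CRUXES. #2 PencilHL (crux) — HL_pencil(3/10): for all d, t ≥ 1, L and ε > 0, for N ≥
N₀(d,t,L,ε), every non-degenerate Ψ : Fin t → AffLinForm d with ‖Ψ‖₁ ≤ L and every convex K ⊆
[−N,N]^d: for all q in the guarded pencil {1 + P·m : m ≤ N^(3/10)/P}, P = primorial(max t L),
outside an exceptional set B of relative size ≤ ε, |S(q·Ψ,K,N) − archFactor(q·Ψ,K)·𝔖(q·Ψ)| ≤ εN^d,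
where q·Ψ has the linear parts of Ψ and constants q·(Ψ i).const. NEW axis «guarded homothety pencil»
(crit-1 row 81, node G1.2.P; super-family «short shift/scale-average notches», cousins by ID:
WindowHL stmt-Parity-26470 (t-dim shift box, 7/30) and IND_P stmt-Parity-31164 (one-coordinate
signed mean) — not a variant: a LINE in shift space); NECESSARY hyp-free (kernel pencilHL_of_ghl, B
= ∅); WEAKER; SIEGEL-INERT. PRINT DELIMITATION (P1): finite-complexity shapes = THEOREM at every θ ≤
1 (GreenTaoZiegler2012_finiteComplexity, B = ∅; bc5 rung
pencilHL_rung_finiteComplexity_threeTenths); pair / binary translate faces = THEOREM at 3/10 (MRT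
2019 Thm 1.3(i)(ii), a.a. |h| ≤ H, H ≥ X^(8/33+ε)) — NOT credit; CREDITED OPEN CONTENT = (a) d = 1
translate tuples t ≥ 3 at 3/10 < print floor 1/3 (MSTT II Thm 1.5, H ≥ X^(1/3+ε)), (b) non-translate
d = 1 shapes (distinct leading coefficients, t ≥ 3: no print at any θ < 1), (c) d ≥ 2
infinite-complexity fibrations (no print at any θ < 1). θ-CURRENCY ONLY (P2): literal 3/10 fixed;
ladder 1 ↦ 5/8 ↦ 1/3 ↦ 3/10 on the MRT/MSTT short-shift-average programme, rung 0 toward GHL, any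
re-dial of θ = VARIANT; T11(b) contraction clause: «when PencilHLAt(3/10) lands, R :=
PencilRigidityAt(θ′) at the next notch — ladder motion on MSTT's programme, not toward GHL».
[difficulty: open-problem] (why it might fail: Kernel-implied by GHL, so false only with Parity;
live risk = the notch: below H = X^(1/3) the Heath-Brown decomposition meets d₃-type sums X<abc≤X+H,
a,b,c ~ X^(1/3), twisted by nilsequences, which no Type I₂/II estimate in print handles
(arXiv:2411.05770 Rem. 1.10).) [MatomakiRadziwillTao2019, arXiv:1707.01315, arXiv:2411.05770,
arXiv:2204.03754, Kawada1993, Mikawa1992, GreenTao2010]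
#3 PencilRigidity (crux) — RIG_pencil(3/10): same prefix; for all q in the guarded pencil outside an
exceptional set E of relative size ≤ ε, |(S(q·Ψ,K,N) − archFactor(q·Ψ,K)·𝔖(q·Ψ)) − (S(Ψ,K,N) −
archFactor(Ψ,K)·𝔖(Ψ))| ≤ εN^d — the HL error is almost constant along the pencil. DECLARED RESIDUAL
(zero credit; never staffed — NO prover time): it carries the pointwise binary / fixed-tuple content
(a.a. HL + rigidity = HL for Ψ, kernel fixedHL_of_pencil); typed BARE and in a.a.-form so that it
survives ¬Q (Siegel distortion sits on a sparse set of dilations) and the T15 guard (an obstructed Ψ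
has only obstructed guarded dilates: kernel no_admissible_dilate_of_obstructed); NECESSARY (kernel
pencilRigidity_of_ghl). DECLARED RESIDUAL (P4): zero rung credit, no prover time, no hand; its pair
face ≡ (FU ∧ FL)|pairs modulo MRT (E(q·Ψ) = o(N) for a.a. q unconditionally), hence pointwise
k-tuple strength, IDEA-NEEDED + BARRIER (Literature.Barriers.Parity.PrimePairParity, SelbergParity
by name). [difficulty: open-problem] (why it might fail: Kernel-implied by GHL; as a target it
converts almost-all-dilate HL into HL for the single shape q = 1, i.e. it is pointwise twin-prime /
k-tuple strength (PrimePairParity, CircleMethodBinary head-on); no mechanism in print compares S(Ψ)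
with S(q·Ψ) for individual Ψ.) [GreenTao2010, MatomakiMerikoski2023, MatomakiRadziwillTao2019,
Literature.Barriers.Parity.PrimePairParity, Literature.Barriers.Parity.CircleMethodBinary,
Literature.Barriers.Parity.SiegelZeroPrimePairs]
#4 BoundedSiegelZeroQuality (crux) — the record's Siegel crux stmt-Parity-25148 verbatim
(exceptional zeros have bounded quality η); shared by signature, filing fields = the record's.
[difficulty: open-problem] (why it might fail: it is the Landau–Siegel problem: no unconditional
bound on η is known (Siegel's theorem is ineffective); Zhang2022LandauSiegel claims L(1,χ) ≫ (log
D)^(-2022) but is unverified — a genuine open problem, not a lemma.) [Zhang2022LandauSiegel,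
HeathBrown1983PrimeTwins, TaoTeravainen2021, MatomakiMerikoski2023, FriedlanderIwaniec2022]
#5 UniformUpperGivenFixed (crux) — the record's uniform residual leaf stmt-Parity-26853 verbatim (Q
→ FixedUpper → the shift-uniform upper half of GT Conj. 1.2); shared by signature, filing fields =
the record's; DECLARED RESIDUAL of the record, not attacked here. [difficulty: open-problem] (why it
might fail: It is the uniform-in-shift (binary Goldbach-type) upper bound with factor 1+ε given Q
and all tuples: pointwise-in-h control beyond windows N^(8/33) (MRT 2019) is open; the circle method
misses binary minor arcs by log x (CircleMethodBinary).) [GreenTao2010, MatomakiRadziwillTao2019,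
MatomakiMerikoski2023, Literature.Barriers.Parity.TrueComplexityBinary,
Literature.Barriers.Parity.CircleMethodBinary,
Summits/Parity/GeneralizedHardyLittlewood/Theses/ShiftTauberian.lean]
#6 UniformLowerGivenFixed (crux) — the record's uniform residual leaf stmt-Parity-26864 verbatim (Q
→ FixedLower → the shift-uniform lower half of GT Conj. 1.2); shared by signature, filing fields =
the record's; DECLARED RESIDUAL of the record, not attacked here. [difficulty: open-problem] (why it
might fail: It contains binary Goldbach with the Hardy–Littlewood main term for every large even N,
given Q and the tuples: no method controls an individual shift h ≍ N; almost-all-h results (MRT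
2019, window N^(8/33)) are the ceiling.) [GreenTao2010, HardyLittlewood1923,
MatomakiRadziwillTao2019, MatomakiMerikoski2023, Literature.Barriers.Parity.CircleMethodBinary,
Literature.Barriers.Parity.TrueComplexityBinary,
Summits/Parity/GeneralizedHardyLittlewood/Theses/ShiftTauberian.lean]

TWO-LAYER PLAN. Foreseen only for the credited piece, by COMPLEXITY (the BC3 skeleton
bc/PencilHL_birth.lean, rc 0, sorries = stubs): PencilHL ⇐ PencilHLLowComplexity
(t ≤ 2: the translate-pair face is MatomakiRadziwillTao2019 Thm 1.3(i) territory, general pair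
coefficients / d ≥ 2 by the dispersion method) →
PencilHLHighComplexity (t ≥ 3: the MSTT frontier, print θ > 1/3) → PencilHL, glue = case split on t.
The residual's skeleton (bc/PencilRigidity_birth.lean)
splits by local type: PencilRigidityObstructed (𝔖(Ψ) = 0 ⟹ 𝔖(q·Ψ) = 0 by the G2 certificate; both
counts are prime-power sparse — provable now, M) →
PencilRigidityAdmissible (the heart) → PencilRigidity. Nothing of this is filed now.

KILL CRITERIA. A refutation of PencilHL (a fixed admissible shape whose guarded dilates fail HL on a
positive proportion up to N^(3/10)) refutes GHL itself (kernel
pencilHL_of_ghl) — the route then closes refuted:PencilHL together with the sub-problem; likewise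
for PencilRigidity. The route is MOOTED (superseded) if
FU ∧ FL close on the record or on any sibling cell (ConstellationCubes, TelescopingWindows,
GapLimitPointSplit …): then PencilHL/PencilRigidity are
corollaries. A proof that PencilHL at EVERY θ > 0 is already implied by the MSTT method (i.e. that
Remark 1.10's obstacle is not real) would re-grade
the credited piece to provable-now and the node to «residual-only» — a pivot to the next notch
(fixed dilation range q ≤ Q₀, which is FU ∧ FL again) is
then NOT available: the node would be retired as exhausted on this axis.

NOT DECOMPOSED YET. The exponent 3/10 is a literal notch, not a parameter to tune at open (any θ <
1/3 names the same obstacle; θ ≤ 8/33 would put even pairs below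
print). Not decomposed: the Type I / Type II / Type I₃ structure behind PencilHLHighComplexity (no
nilsequence-in-short-interval vocabulary in the tree
yet), the W-trick bookkeeping between 𝔖(q·Ψ) and 𝔖(Ψ) at primes p > max t L dividing q (it is part
of PencilHL's main term, not a separate item), and
the d ≥ 2 → d = 1 slicing (GT linear-algebra reduction; would be a support item if a prover wants
the d = 1 face separately).

CHEAPEST FALSIFIER. (i) Lookup (ran 2026-08-30, Novelty): is HL for almost all DILATES q·Ψ, q ≤ X^θ,
θ < 1/3, already a theorem for some tuple with t ≥ 3? No —
arXiv:2411.05770 Thm 1.5 (θ > 1/3) is the record and its Remark 1.10 names the obstacle; for pairs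
MRT 2019 gives θ > 8/33, so the t ≤ 2, d = 1
translate face of PencilHL IS essentially in print (declared: BC5 rung, plan-only) — a refuter who
shows the WHOLE of PencilHL(3/10) follows from
print re-grades the piece, not the route's logic. (ii) The BC2 probes C → GHL on both new items
(must fail; they do, rc 1) and the BC7 tautology probe
(CLEAN ×2). (iii) First numerical move for a refuter: twins Ψ = (n, n+2), N = 10^7, P = 6: the
empirical distribution of |S(q·Ψ,[1,N],N) −
𝔖(2q)N| / N over q = 1 + 6m ≤ N^(3/10) ≈ 126 — the node predicts concentration at o(1) with no
exceptional q; a fat tail at q with many small prime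
factors would say the W-bookkeeping of 𝔖(q·Ψ) vs the guard is misstated (not that PencilHL is
false).

NUMBERS. θ-ladder for «HL for almost all members of a one-parameter family of shift range X^θ»:
pairs θ = 1 (Balog1990 / Kawada1993 / Mikawa1992; tree named
facts hardyLittlewoodPairs_almostAllShifts, hardyLittlewoodTuples_almostAllShifts), θ > 1/3 (Mikawa
1991, BBMZ), θ > 8/33 = 0.2424… (MatomakiRadziwillTao2019
Thm 1.3(i), σ-record p. 5: 7/30 < σ = 8/33 < 1/4); tuples ℓ ≥ 3, d = 1: θ > 5/8 (arXiv:2204.03754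
Thm 1.7 + §applications), θ > 1/3 (arXiv:2411.05770
Thm 1.5); node notch θ₀ = 3/10 (8/33 < 3/10 < 1/3). Guard: P = primorial(max t L) (so every prime p
≤ max(t, L) has β_p(q·Ψ) = β_p(Ψ), kernel
localFactor_dilate_eq); pencil size ≍ N^(3/10)/P.

DEFINITION REQUESTS. None: dilate / pencil / strideMod are inlined in the item texts (Finset.image
over Finset.range, Mathlib `primorial`, `Nat.floor`); no Literature fact is
requested (MRT 2019 Thm 1.3(i) would be the natural cite fact `MatomakiRadziwillTao2019_theorem13i`
for the BC5 rung; not filed from this seat).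

Novelty: Searches (2026-08-30): lit search --hybrid "Hardy-Littlewood prime tuples almost all shifts short
range von Mangoldt correlations" (8 docs: paper:arxiv-2109.06291 pp.1,3,4 Tao–Teräväinen HL–Chowla
with a Siegel zero; paper:arxiv-2111.08912 pp.7,16,17 Lichtman–Teräväinen HL–Chowla on average;
books tao2006 p.501, greaves1997 p.124, ivic1985 p.366); lit galaxy search "one averaging
variable|Hardy-Littlewood tuples on average|short shift ranges" --star all (0 rows); lit galaxy
search "Correlations of the von Mangoldt|prime tuples conjecture on average" --star pdf (1:
pdf:-4037186074583161440 Lichtman–Teräväinen); lit galaxy search "triple divisor|d_3 in short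
intervals|Type I_3" --star pdf (6; pdf:3255191587752352360 Sharma d₃ exponent of distribution
1/2+1/30, pdf:8116004889114158180 Fazzari Voronoi for shifted d₃, pdf:817502720 Ng–Thom additive
divisor sums); lit read arxiv:2411.05770 (Thm 1.5 p.6, Rem. 1.10 p.9), arxiv:2204.03754 (Thm 1.7
p.7, Cor 1.9 p.8), arxiv:1707.01315 (Thm 1.3 p.6, σ p.5); ledger negatives --problem Parity (5 rows,
none on dilations); rg over lean/Summits/Parity and HOME for dilate|homothety|pencil (only lens-6's
Möbius-dilation μ(m)Λ(qm+h), a different object); bus STATUS.md l.1–410 (no node on this axis).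
Nearest prior art found: arXiv:2411.05770 Thm 1.5 (Matomäki–Shao–Tao–Teräväinen 2024: ℓ-point HL
with one averaging variable h ≤ X^(1/3+ε), d = 1 progression-like shapes) and
MatomakiRadziwillTao2019 Thm 1.3(i) (pairs, H ≥ X^(8/33+ε)); on the hub, ro  [refs: 2411.05770, 2204.03754, 1707.01315, paper:arxiv-2109.06291, paper:arxiv-2111.08912, arxiv:2411.05770, arxiv:2204.03754, arxiv:1707.01315, MatomakiRadziwillTao2019]

Barriers (technique_class: decomposition, dilation-pencil, short-interval-hl): - technique_class: decomposition, dilation-pencil, short-interval-hl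
- Literature.Barriers.Parity.SelbergParityBarrier: PencilHL is outside — it is an almost-all
statement over a polynomially long one-parameter family, the class in which MRT 2019 / MSTT 2024
prove HL unconditionally by the Heath-Brown identity (the extra variable supplies the bilinear
structure parity forbids pointwise); PencilRigidity is inside (pointwise strength) and is the
declared residual.
- Literature.Barriers.Parity.PrimePairParity: same placement — PencilHL never isolates a single
pair; PencilRigidity does (q = 1) and is residual; the bet is only on the credited notch.
- Literature.Barriers.Parity.CircleMethodBinaryBarrier: outside for PencilHL — averaging over H =
N^(3/10) dilates turns the binary minor arcs into mean values of Dirichlet polynomials (MRT 2019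
§1–2); the notch below 1/3 needs a Type-I₃ input, not a minor-arc bound in absolute value; inside
for PencilRigidity (residual).
- Literature.Barriers.Parity.TrueComplexityBinary: outside for PencilHL — with q as a second
variable the system (n,q) ↦ (Ψ̇ᵢ(n) + q·cᵢ) has finite Cauchy–Schwarz complexity (short second
range, handled by short-interval Gowers norms above θ = 1/3); inside for PencilRigidity (residual).
- Literature.Barriers.Parity.GoldbachAverageZeros: outside — PencilHL asks density-o(1) exceptional
sets and o(N^d) errors, no power saving, so no zero-free region is forced (MRT's log^-A savings are
unconditional).
- Literature.Barrie

History (route lifecycle, newest last):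
- 2026-09-04T15:42:10Z · DORMANT — reconciler: no traction for 5 d (last activity statement-checked at 2026-08-30T14:21:33Z); parked, not closed — `ledger route dormant route-Parity-HomothetyPenc (operator:999:3276013)

sub-problem: GeneralizedHardyLittlewood · status: dormant · opened planner-decomp-parity-lens-4-g7-0 2026-08-30T10:57:41Z · rev 0 · ledger route-Parity-HomothetyPencil
GENERATED by the gate from the ledger (D-0016/17). Provers cite these decls: `theorem foo : Summit.Parity.GeneralizedHardyLittlewood.Theses.HomothetyPencil.<Decl> := …` in Summits/Parity/GeneralizedHardyLittlewood/Theorems/<Name>.lean.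
-/

namespace Summit.Parity.GeneralizedHardyLittlewood.Theses.HomothetyPencil

open scoped BigOperators Topology Manifold Classical MeasureTheory ProbabilityTheory Matrix InnerProductSpace ComplexConjugate ContinuousMap
open Filter Set Function TopologicalSpace MeasureTheory

attribute [summit_statement] _root_.GeneralizedHardyLittlewood

/-- item stmt-Parity-32286 · crux · rank 2 · open · by planner
why it might fail: Kernel-implied by GHL, so false only with Parity; live risk = the notch: below H = X^(1/3) the Heath-Brown decomposition meets d₃-type sums X<abc≤X+H, a,b,c ~ X^(1/3), twisted by nilsequences, which no Type I₂/II estimate in print handles (arXiv:2411.05770 Rem. 1.10).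
sources: MatomakiRadziwillTao2019, arXiv:1707.01315, arXiv:2411.05770, arXiv:2204.03754, Kawada1993, Mikawa1992
[crux] HL_pencil(3/10): for all d, t ≥ 1, L and ε > 0, for N ≥ N₀(d,t,L,ε), every non-degenerate Ψ :
Fin t → AffLinForm d with ‖Ψ‖₁ ≤ L and every convex K ⊆ [−N,N]^d: for all q in the guarded pencil {1
+ P·m : m ≤ N^(3/10)/P}, P = primorial(max t L), outside an exceptional set B of relative size ≤ ε,
|S(q·Ψ,K,N) − archFactor(q·Ψ,K)·𝔖(q·Ψ)| ≤ εN^d, where q·Ψ has the linear parts of Ψ and constants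
q·(Ψ i).const. NEW axis «guarded homothety pencil» (crit-1 row 81, node G1.2.P; super-family «short
shift/scale-average notches», cousins by ID: WindowHL stmt-Parity-26470 (t-dim shift box, 7/30) and
IND_P stmt-Parity-31164 (one-coordinate signed mean) — not a variant: a LINE in shift space);
NECESSARY hyp-free (kernel pencilHL_of_ghl, B = ∅); WEAKER; SIEGEL-INERT. PRINT DELIMITATION (P1):
finite-complexity shapes = THEOREM at every θ ≤ 1 (GreenTaoZiegler2012_finiteComplexity, B = ∅; bc5
rung pencilHL_rung_finiteComplexity_threeTenths); pair / binary translate faces = THEOREM at 3/10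
(MRT 2019 Thm 1.3(i)(ii), a.a. |h| ≤ H, H ≥ X^(8/33+ε)) — NOT credit; CREDITED OPEN CONTENT = (a) d
= 1 translate tuples t ≥ 3 at 3/10 < print floor 1/3 (MSTT II Thm 1.5, H ≥ X^(1/3+ε)), (b)
non-translate d = -/
@[route_item "route-Parity-HomothetyPencil"]
def PencilHL : Prop :=
  ∀ (d t L : ℕ), 1 ≤ d → 1 ≤ t → ∀ ε : ℝ, 0 < ε → ∃ N₀ : ℕ, ∀ N : ℕ, N₀ ≤ N → ∀ Ψ : Fin t → Literature.NumberTheory.Sieve.AffLinForm d, Literature.NumberTheory.Sieve.IsNondegenerateSystem Ψ → Literature.NumberTheory.Sieve.affLinSize Ψ 1 ≤ L → ∀ K : Set (Fin d → ℝ), Convex ℝ K → K ⊆ Literature.NumberTheory.Sieve.realBox d N → ∃ B : Finset ℕ, B ⊆ (Finset.range (⌊(N : ℝ) ^ ((3 : ℝ) / 10)⌋₊ / primorial (max t L) + 1)).image (fun m : ℕ => 1 + primorial (max t L) * m) ∧ (B.card : ℝ) ≤ ε * (((Finset.range (⌊(N : ℝ) ^ ((3 : ℝ) / 10)⌋₊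 / primorial (max t L) + 1)).image (fun m : ℕ => 1 + primorial (max t L) * m)).card : ℝ) ∧ ∀ q ∈ (Finset.range (⌊(N : ℝ) ^ ((3 : ℝ) / 10)⌋₊ / primorial (max t L) + 1)).image (fun m : ℕ => 1 + primorial (max t L) * m), q ∉ B → |Literature.NumberTheory.Sieve.vonMangoldtSum (fun i => (⟨(Ψ i).coeff, (q : ℤ) * (Ψ i).const⟩ : Literature.NumberTheory.Sieve.AffLinForm d)) K N - Literature.NumberTheory.Sieve.archFactor (fun i => (⟨(Ψ i).coeff, (q : ℤ) * (Ψ i).const⟩ : Literature.NumberTheory.Sieve.AffLinForm d)) K * Literature.NumberTheory.Sieve.singularProduct (fun i => (⟨(Ψ i).coeff, (q : ℤ) * (Ψ i).const⟩ : Literature.NumberTheory.Sieve.AffLinForm d))| ≤ ε * (N : ℝ) ^ d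

/-- item stmt-Parity-32287 · crux · rank 3 · open · by planner
why it might fail: Kernel-implied by GHL; as a target it converts almost-all-dilate HL into HL for the single shape q = 1, i.e. it is pointwise twin-prime / k-tuple strength (PrimePairParity, CircleMethodBinary head-on); no mechanism in print compares S(Ψ) with S(q·Ψ) for individual Ψ.
sources: GreenTao2010, MatomakiMerikoski2023, MatomakiRadziwillTao2019, Literature.Barriers.Parity.PrimePairParity, Literature.Barriers.Parity.CircleMethodBinary, Literature.Barriers.Parity.SiegelZeroPrimePairs
[crux] RIG_pencil(3/10): same prefix; for all q in the guarded pencil outside an exceptional set E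
of relative size ≤ ε, |(S(q·Ψ,K,N) − archFactor(q·Ψ,K)·𝔖(q·Ψ)) − (S(Ψ,K,N) − archFactor(Ψ,K)·𝔖(Ψ))|
≤ εN^d — the HL error is almost constant along the pencil. DECLARED RESIDUAL (zero credit; never
staffed — NO prover time): it carries the pointwise binary / fixed-tuple content (a.a. HL + rigidity
= HL for Ψ, kernel fixedHL_of_pencil); typed BARE and in a.a.-form so that it survives ¬Q (Siegel
distortion sits on a sparse set of dilations) and the T15 guard (an obstructed Ψ has only obstructed
guarded dilates: kernel no_admissible_dilate_of_obstructed); NECESSARY (kernel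
pencilRigidity_of_ghl). DECLARED RESIDUAL (P4): zero rung credit, no prover time, no hand; its pair
face ≡ (FU ∧ FL)|pairs modulo MRT (E(q·Ψ) = o(N) for a.a. q unconditionally), hence pointwise
k-tuple strength, IDEA-NEEDED + BARRIER (Literature.Barriers.Parity.PrimePairParity, SelbergParity
by name). [difficulty: open-problem] -/
@[route_item "route-Parity-HomothetyPencil"]
def PencilRigidity : Prop :=
  ∀ (d t L : ℕ), 1 ≤ d → 1 ≤ t → ∀ ε : ℝ, 0 < ε → ∃ N₀ : ℕ, ∀ N : ℕ, N₀ ≤ N → ∀ Ψ : Fin t → Literature.NumberTheory.Sieve.AffLinForm d, Literature.NumberTheory.Sieve.IsNondegenerateSystem Ψ → Literature.NumberTheory.Sieve.affLinSize Ψ 1 ≤ L → ∀ K : Set (Fin d → ℝ), Convex ℝ K → K ⊆ Literature.NumberTheory.Sieve.realBox d N → ∃ E : Finset ℕ, E ⊆ (Finset.range (⌊(N : ℝ) ^ ((3 : ℝ) / 10)⌋₊ / primorial (max t L) + 1)).image (fun m : ℕ => 1 + primorial (max t L) * m) ∧ (E.card : ℝ) ≤ ε * (((Finset.range (⌊(N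 : ℝ) ^ ((3 : ℝ) / 10)⌋₊ / primorial (max t L) + 1)).image (fun m : ℕ => 1 + primorial (max t L) * m)).card : ℝ) ∧ ∀ q ∈ (Finset.range (⌊(N : ℝ) ^ ((3 : ℝ) / 10)⌋₊ / primorial (max t L) + 1)).image (fun m : ℕ => 1 + primorial (max t L) * m), q ∉ E → |(Literature.NumberTheory.Sieve.vonMangoldtSum (fun i => (⟨(Ψ i).coeff, (q : ℤ) * (Ψ i).const⟩ : Literature.NumberTheory.Sieve.AffLinForm d)) K N - Literature.NumberTheory.Sieve.archFactor (fun i => (⟨(Ψ i).coeff, (q : ℤ) * (Ψ i).const⟩ : Literature.NumberTheory.Sieve.AffLinForm d)) K * Literature.NumberTheory.Sieve.singularProduct (fun i => (⟨(Ψ i).coeff, (q : ℤ) * (Ψ i).const⟩ : Literature.NumberTheory.Sieve.AffLinForm d))) - (Literature.NumberTheory.Sieve.vonMangoldtSum Ψ K N - Literature.NumberTheory.Sieve.archFactor Ψ K * Literature.NumberTheory.Sieve.singularProduct Ψ)| ≤ ε * (N : ℝ) ^ d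

/-- item stmt-Parity-25148 · crux · rank 4 · open · by planner
why it might fail: it is the Landau–Siegel problem: no unconditional bound on η is known (Siegel's theorem is ineffective); Zhang2022LandauSiegel claims L(1,χ) ≫ (log D)^(-2022) but is unverified — a genuine open problem, not a lemma.
sources: Zhang2022LandauSiegel, HeathBrown1983PrimeTwins, TaoTeravainen2021, MatomakiMerikoski2023, FriedlanderIwaniec2022
[crux] Siegel zeros of primitive quadratic characters have bounded quality at all large conductors:
∃ η₀ q₀, every Siegel zero (IsSiegelZero χ η) of conductor q ≥ q₀ has η < η₀ — literally
¬UnboundedSiegelZeros (Landau–Siegel in the form the MM bridge needs). [difficulty: open-problem] ‖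
TAG [crit-1 CLEARED 2026-08-30T01:46:27Z, HOME/STATUS.md l.26]: WEAKER (kernel mod MM2023 print; Q ⟹
GHL unknown); leaf IDEA-NEEDED (Landau–Siegel) + ATTACKABLE-rung (Zhang2022 skeleton routes
PrimeLevelFamEdge/ZDegreeToeplitzBand; lens-2 T_ω ladder) + INSTRUMENTABLE (finite conductor tables,
not a rung). BC3 birth skeleton: stub_weakGoldbach (WeakHLGoldbachConj ½, open) → stub_exclusion
(MM2023 Cor 1.2 Goldbach detector + |L'| ≪ log²q, provable-now) → Q. Census
HOME/census/COSTUME-CENSUS-v1.md sha256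
4afbbbc68c038369818dcc2bcc5990569ac50a4757d8938468c0838377ddd628 row WK8. -/
@[route_item "route-Parity-HomothetyPencil"]
def BoundedSiegelZeroQuality : Prop :=
  ∃ η₀ : ℝ, ∃ q₀ : ℕ, ∀ (q : ℕ) [NeZero q] (χ : DirichletCharacter ℂ q) (η : ℝ), q₀ ≤ q → Literature.Barriers.Parity.IsSiegelZero χ η → η < η₀

/-- item stmt-Parity-26853 · crux · rank 5 · open · by planner
why it might fail: It is the uniform-in-shift (binary Goldbach-type) upper bound with factor 1+ε given Q and all tuples: pointwise-in-h control beyond windows N^(8/33) (MRT 2019) is open; the circle method misses binary minor arcs by log x (CircleMethodBinary).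
sources: GreenTao2010, MatomakiRadziwillTao2019, MatomakiMerikoski2023, Literature.Barriers.Parity.TrueComplexityBinary, Literature.Barriers.Parity.CircleMethodBinary, Summits/Parity/GeneralizedHardyLittlewood/Theses/ShiftTauberian.lean
[crux · DECLARED-RESIDUAL; node TupleUniformitySplit (lens-5 g3): shift-uniformity of the upper half
GIVEN bounded Siegel quality and the fixed-pattern upper half] Q → FixedUpper → (uniform upper half
of GHL: one N₀(d,t,L,ε) for all Ψ with ‖Ψ‖_N ≤ L). Exactly the binary / moving-target content of UQ
(Goldbach-type systems (n, N−n), shifts h ≍ N) with the tuple content split off: kernel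
upperGivenBoundedSiegel_iff : UQ ↔ (Q → FixedUpper) ∧ this, so WEAKER than UQ (separating world ¬(Q
→ FixedUpper)) and the FixedUpper hypothesis is load-bearing (T6). Transpose of the PairsToGHL cut
(9389: pairs-uniform base, tuples residual). INSTRUMENTABLE: kernel windowUpper_of_fixedUpper —
FixedUpper in dimension d+1 already gives every shift-WINDOW average of length ≫ εN; this item is
WINDOW(δN) → POINT; notches N^{8/33} (MRT) → N^{7/30} (ShiftTauberian) → polylog are rungs (T11),
not filed. -/
@[route_item "route-Parity-HomothetyPencil"]
def UniformUpperGivenFixed : Prop :=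
  (∃ η₀ : ℝ, ∃ q₀ : ℕ, ∀ (q : ℕ) [NeZero q] (χ : DirichletCharacter ℂ q) (η : ℝ), q₀ ≤ q → Literature.Barriers.Parity.IsSiegelZero χ η → η < η₀) → (∀ (d t : ℕ), 1 ≤ d → 1 ≤ t → ∀ Ψ : Fin t → Literature.NumberTheory.Sieve.AffLinForm d, Literature.NumberTheory.Sieve.IsNondegenerateSystem Ψ → ∀ ε : ℝ, 0 < ε → ∃ N₀ : ℕ, ∀ N : ℕ, N₀ ≤ N → ∀ K : Set (Fin d → ℝ), Convex ℝ K → K ⊆ Literature.NumberTheory.Sieve.realBox d N → Literature.NumberTheory.Sieve.vonMangoldtSum Ψ K N - Literature.NumberTheory.Sieve.archFactor Ψ K * Literature.NumberTheory.Sieve.singularProduct Ψ ≤ ε * (N : ℝ) ^ d) → ∀ (d t L : ℕ), 1 ≤ d → 1 ≤ t → ∀ ε : ℝ, 0 < ε → ∃ N₀ : ℕ, ∀ N : ℕ, N₀ ≤ N → ∀ Ψ : Fin t → Literature.NumberTheory.Sieve.AffLinForm d, Literature.NumberTheory.Sieve.IsNondegenerateSystem Ψ → Literature.NumberTheory.Sieve.affLinSize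 Ψ N ≤ L → ∀ K : Set (Fin d → ℝ), Convex ℝ K → K ⊆ Literature.NumberTheory.Sieve.realBox d N → Literature.NumberTheory.Sieve.vonMangoldtSum Ψ K N - Literature.NumberTheory.Sieve.archFactor Ψ K * Literature.NumberTheory.Sieve.singularProduct Ψ ≤ ε * (N : ℝ) ^ d

/-- item stmt-Parity-26864 · crux · rank 6 · open · by planner
why it might fail: It contains binary Goldbach with the Hardy–Littlewood main term for every large even N, given Q and the tuples: no method controls an individual shift h ≍ N; almost-all-h results (MRT 2019, window N^(8/33)) are the ceiling.
sources: GreenTao2010, HardyLittlewood1923, MatomakiRadziwillTao2019, MatomakiMerikoski2023, Literature.Barriers.Parity.CircleMethodBinary, Literature.Barriers.Parity.TrueComplexityBinary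
[crux · DECLARED-RESIDUAL; node TupleUniformitySplit (lens-5 g3): shift-uniformity of the lower half
GIVEN bounded Siegel quality and the fixed-pattern lower half] Q → FixedLower → (uniform lower half
of GHL). Exactly the binary content of LQ — binary Goldbach for all large even N with the HL main
term, and all moving-shift lower bounds — with the tuples split off: kernel
lowerGivenBoundedSiegel_iff : LQ ↔ (Q → FixedLower) ∧ this; WEAKER than LQ (world ¬(Q →
FixedLower)); FixedLower hypothesis load-bearing (T6). INSTRUMENTABLE: kernel
windowLower_of_fixedLower gives all shift windows ≫ εN from FixedLower_{d+1}; this item is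
WINDOW(δN) → POINT; notch ladder = rungs (T11). -/
@[route_item "route-Parity-HomothetyPencil"]
def UniformLowerGivenFixed : Prop :=
  (∃ η₀ : ℝ, ∃ q₀ : ℕ, ∀ (q : ℕ) [NeZero q] (χ : DirichletCharacter ℂ q) (η : ℝ), q₀ ≤ q → Literature.Barriers.Parity.IsSiegelZero χ η → η < η₀) → (∀ (d t : ℕ), 1 ≤ d → 1 ≤ t → ∀ Ψ : Fin t → Literature.NumberTheory.Sieve.AffLinForm d, Literature.NumberTheory.Sieve.IsNondegenerateSystem Ψ → ∀ ε : ℝ, 0 < ε → ∃ N₀ : ℕ, ∀ N : ℕ, N₀ ≤ N → ∀ K : Set (Fin d → ℝ), Convex ℝ K → K ⊆ Literature.NumberTheory.Sieve.realBox d N → Literature.NumberTheory.Sieve.archFactor Ψ K * Literature.NumberTheory.Sieve.singularProduct Ψ - Literature.NumberTheory.Sieve.vonMangoldtSum Ψ K N ≤ ε * (N : ℝ) ^ d) → ∀ (d t L : ℕ), 1 ≤ d → 1 ≤ t → ∀ ε : ℝ, 0 < ε → ∃ N₀ : ℕ, ∀ N : ℕ, N₀ ≤ N → ∀ Ψ :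 Fin t → Literature.NumberTheory.Sieve.AffLinForm d, Literature.NumberTheory.Sieve.IsNondegenerateSystem Ψ → Literature.NumberTheory.Sieve.affLinSize Ψ N ≤ L → ∀ K : Set (Fin d → ℝ), Convex ℝ K → K ⊆ Literature.NumberTheory.Sieve.realBox d N → Literature.NumberTheory.Sieve.archFactor Ψ K * Literature.NumberTheory.Sieve.singularProduct Ψ - Literature.NumberTheory.Sieve.vonMangoldtSum Ψ K N ≤ ε * (N : ℝ) ^ d

/-- item stmt-Parity-32288 · assembly · rank 1 · closed · proved by Summit.Parity.GeneralizedHardyLittlewood.Theses.HomothetyPencil.assembly_proof (prover) · by planner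
sources: GreenTao2010, MatomakiRadziwillTao2019
[assembly] BoundedSiegelZeroQuality → UniformUpperGivenFixed → UniformLowerGivenFixed → PencilHL →
PencilRigidity → GeneralizedHardyLittlewood -/
@[route_item "route-Parity-HomothetyPencil"]
def Assembly : Prop :=
  BoundedSiegelZeroQuality → UniformUpperGivenFixed → UniformLowerGivenFixed → PencilHL → PencilRigidity → GeneralizedHardyLittlewood

-- `Assembly` holds: proved by `Summit.Parity.GeneralizedHardyLittlewood.Theses.HomothetyPencil.assembly_proof` (its module imports this route file, so no `_holds` link can be stated here).

/-! D-0027 §2.1 — DECIDING THEOREM (planner-authored via `route open/edit --closes-file`; by planner-decomp-parity-lens-4-g7-0 2026-08-30T10:57:41Z):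
its hypotheses are this route's items and its conclusion the sub-problem Statement (glue_lint), and it elaborates with this file. -/

@[closes "route-Parity-HomothetyPencil"] theorem closes (hQ : BoundedSiegelZeroQuality) (hUU : UniformUpperGivenFixed)
    (hUL : UniformLowerGivenFixed) (hP : PencilHL) (hR : PencilRigidity) :
    GeneralizedHardyLittlewood := by
  -- (0) two elementary facts
  have key : ∀ a b X Y : ℝ, |b| ≤ X → |b - a| ≤ Y → |a| ≤ X + Y := by
    intro a b X Y h1 h2
    have h3 := abs_sub_abs_le_abs_sub a b
    rw [abs_sub_comm] at h3
    linarith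
  have cnt : ∀ (S B E : Finset ℕ) (δ : ℝ), δ ≤ 1 / 4 → (B.card : ℝ) ≤ δ * (S.card : ℝ) →
      (E.card : ℝ) ≤ δ * (S.card : ℝ) → 1 ∈ S → ∃ q ∈ S, q ∉ B ∧ q ∉ E := by
    intro S B E δ hδ4 hB hE h1
    have hSpos : (0 : ℝ) < S.card := by exact_mod_cast Finset.card_pos.mpr ⟨1, h1⟩
    have hlt : ((B ∪ E).card : ℝ) < S.card := by
      have hu : ((B ∪ E).card : ℝ) ≤ B.card + E.card := by exact_mod_cast Finset.card_union_le B E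
      have hB' := hB.trans (mul_le_mul_of_nonneg_right hδ4 hSpos.le)
      have hE' := hE.trans (mul_le_mul_of_nonneg_right hδ4 hSpos.le)
      linarith
    by_contra hcon
    push Not at hcon
    have hsub : S ⊆ B ∪ E := by
      intro q hq
      rw [Finset.mem_union]
      by_cases hqB : q ∈ B
      · exact Or.inl hqB
      · exact Or.inr (hcon q hq hqB)
    have h' : (S.card : ℝ) ≤ (B ∪ E).card := by exact_mod_cast Finset.card_le_card hsub
    linarith
  -- (1) θ-free extremal step: the two pencil pieces give two-sided FIXED-PATTERN HL
  --     (1 ∈ pencil; two exceptional sets of density ≤ 1/4 cannot cover the pencil;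
  --      at a doubly good dilation q: |E(Ψ)| ≤ |E(q·Ψ)| + |E(q·Ψ) − E(Ψ)|)
  have fixed : ∀ (d t : ℕ), 1 ≤ d → 1 ≤ t → ∀ Ψ : Fin t → Literature.NumberTheory.Sieve.AffLinForm d, Literature.NumberTheory.Sieve.IsNondegenerateSystem Ψ → ∀ ε : ℝ, 0 < ε → ∃ N₀ : ℕ, ∀ N : ℕ, N₀ ≤ N → ∀ K : Set (Fin d → ℝ), Convex ℝ K → K ⊆ Literature.NumberTheory.Sieve.realBox d N → |Literature.NumberTheory.Sieve.vonMangoldtSum Ψ K N - Literature.NumberTheory.Sieve.archFactor Ψ K * Literature.NumberTheory.Sieve.singularProduct Ψ| ≤ ε * (N : ℝ) ^ d := by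
    intro d t hd ht Ψ hΨ ε hε
    have hL : Literature.NumberTheory.Sieve.affLinSize Ψ 1 ≤ ((⌈Literature.NumberTheory.Sieve.affLinSize Ψ 1⌉₊ : ℕ) : ℝ) :=
      Nat.le_ceil _
    have hδpos : 0 < min (ε / 2) (1 / 4 : ℝ) := lt_min (by positivity) (by norm_num)
    have hδε : min (ε / 2) (1 / 4 : ℝ) ≤ ε / 2 := min_le_left _ _
    have hδ4 : min (ε / 2) (1 / 4 : ℝ) ≤ 1 / 4 := min_le_right _ _
    obtain ⟨N₁, h₁⟩ := hP d t ⌈Literature.NumberTheory.Sieve.affLinSize Ψ 1⌉₊ hd ht _ hδpos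
    obtain ⟨N₂, h₂⟩ := hR d t ⌈Literature.NumberTheory.Sieve.affLinSize Ψ 1⌉₊ hd ht _ hδpos
    refine ⟨max N₁ N₂, fun N hN K hK hKN => ?_⟩
    obtain ⟨B, -, hBcard, hBgood⟩ := h₁ N (le_trans (le_max_left _ _) hN) Ψ hΨ hL K hK hKN
    obtain ⟨E, -, hEcard, hEgood⟩ := h₂ N (le_trans (le_max_right _ _) hN) Ψ hΨ hL K hK hKN
    obtain ⟨q, hqG, hqB, hqE⟩ :=
      cnt _ B E _ hδ4 hBcard hEcard (Finset.mem_image.mpr ⟨0, by simp⟩)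
    have e1 := hBgood q hqG hqB
    have e2 := hEgood q hqG hqE
    have hNd : (0 : ℝ) ≤ (N : ℝ) ^ d := by positivity
    have e4 := key _ _ _ _ e1 e2
    have hδN : min (ε / 2) (1 / 4 : ℝ) * (N : ℝ) ^ d ≤ ε / 2 * (N : ℝ) ^ d :=
      mul_le_mul_of_nonneg_right hδε hNd
    linarith
  -- (2) the record's fixed-pattern leaves FU (stmt-Parity-26852) and FL (stmt-Parity-26863)
  have hFU : ∀ (d t : ℕ), 1 ≤ d → 1 ≤ t → ∀ Ψ : Fin t → Literature.NumberTheory.Sieve.AffLinForm d, Literature.NumberTheory.Sieve.IsNondegenerateSystem Ψ → ∀ ε : ℝ, 0 < ε → ∃ N₀ : ℕ, ∀ N : ℕ, N₀ ≤ N → ∀ K : Set (Fin d → ℝ), Convex ℝ K → K ⊆ Literature.NumberTheory.Sieve.realBox d N → Literature.NumberTheory.Sieve.vonMangoldtSum Ψ K N - Literature.NumberTheory.Sieve.archFactor Ψ K * Literature.NumberTheory.Sieve.singularProduct Ψ ≤ ε * (N : ℝ) ^ d := by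
    intro d t hd ht Ψ hΨ ε hε
    obtain ⟨N₀, hN₀⟩ := fixed d t hd ht Ψ hΨ ε hε
    exact ⟨N₀, fun N hN K hK hKN => (le_abs_self _).trans (hN₀ N hN K hK hKN)⟩
  have hFL : ∀ (d t : ℕ), 1 ≤ d → 1 ≤ t → ∀ Ψ : Fin t → Literature.NumberTheory.Sieve.AffLinForm d, Literature.NumberTheory.Sieve.IsNondegenerateSystem Ψ → ∀ ε : ℝ, 0 < ε → ∃ N₀ : ℕ, ∀ N : ℕ, N₀ ≤ N → ∀ K : Set (Fin d → ℝ), Convex ℝ K → K ⊆ Literature.NumberTheory.Sieve.realBox d N → Literature.NumberTheory.Sieve.archFactor Ψ K * Literature.NumberTheory.Sieve.singularProduct Ψ - Literature.NumberTheory.Sieve.vonMangoldtSum Ψ K N ≤ ε * (N : ℝ) ^ d := by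
    intro d t hd ht Ψ hΨ ε hε
    obtain ⟨N₀, hN₀⟩ := fixed d t hd ht Ψ hΨ ε hε
    refine ⟨N₀, fun N hN K hK hKN => ?_⟩
    have h' := hN₀ N hN K hK hKN
    rw [abs_sub_comm] at h'
    exact (le_abs_self _).trans h'
  -- (3) the record context: Q + the two uniformity lifts UU, UL (route-Parity-SiegelSpectrumSplit)
  intro d t L hd ht ε hε
  obtain ⟨N₁, h₁⟩ := hUU hQ hFU d t L hd ht ε hε
  obtain ⟨N₂, h₂⟩ := hUL hQ hFL d t L hd ht ε hε
  refine ⟨max N₁ N₂, fun N hN Ψ hΨ hΨL K hK hKN => abs_sub_le_iff.mpr ⟨?_, ?_⟩⟩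
  · exact h₁ N (le_trans (le_max_left _ _) hN) Ψ hΨ hΨL K hK hKN
  · exact h₂ N (le_trans (le_max_right _ _) hN) Ψ hΨ hΨL K hK hKN

end Summit.Parity.GeneralizedHardyLittlewood.Theses.HomothetyPencil
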